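import Literature.NumberTheory.Weil1964.AdelicMetaplecticSeesawSum
import Literature.NumberTheory.Weil1964.AdelicDoublingDiagonalLift
import Literature.NumberTheory.Weil1964.AdelicSchrodingerConjCont
import HarnessLib

/-!
# The doubling lift on the `W`-diagonal versus `ω ⊗ ω̄`: the defect character of `Mp_ψ(W_𝔸)ᶜᵒⁿᵗ`

Topic `NumberTheory/Weil1964`; namespace `Literature.NumberTheory.Weil1964`.  KERNEL MATHEMATICS ONLY: one definition
with body (`doublingDefectChar`, an instance of the tree's see-saw character `mpSeesawCharSum`) and theorems; no
`def … : Prop`, no `axiom`, no proof hole.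

SETTING.  `W = W_T` the adelic symplectic space with invertible Gram matrix `T ∈ GL_n(𝔸_F)` (`adelicForm F (Fin n) T`),
`W ⊕ W⁻` its DOUBLE with Gram matrix `doubledGramFin F T = reindex (T ⊕ (−T))` on `Fin (n + n)`, Weil's continuous
metaplectic groups `Mp_ψ(W_𝔸)ᶜᵒⁿᵗ = adelicMpCont F (Fin n) T`, `Mp_ψ((W ⊕ W⁻)_𝔸)ᶜᵒⁿᵗ`, the tree's DOUBLING LIFT
`S̃ = doublingLift F T hT : Sp(W_𝔸) →* Mp_ψ((W ⊕ W⁻)_𝔸)ᶜᵒⁿᵗ`, `S̃(g) = r_F(δ)⁻¹ 𝐫₀(δ g^Δ δ⁻¹) r_F(δ)` over the diagonal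
`g ↦ g^Δ` (`AdelicDoublingDiagonalLift`, [GelbartPiatetskishapiroRallis1987, Part A §2]; [Kudla1996, V.3]), and the
conjugate model `x ↦ xᶜ : Mp_ψ(W_T)ᶜᵒⁿᵗ ≃* Mp_ψ(W_{−T})ᶜᵒⁿᵗ`, `ω_{−T}(xᶜ) Ψ = C (ω_T(x) (C Ψ))`
(`AdelicSchrodingerConjCont`, [Li1992, p. 181]: «`ω*` is `ω_{ψ̄}`»).

For `x = (g, M) ∈ Mp_ψ(W_𝔸)ᶜᵒⁿᵗ` BOTH `ω(S̃(g))` and `M ⊠ C M C` (read on `𝒮(𝔸^{n+n})` through `Fin (n + n) ≃ Fin n ⊕ Fin n`)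
implement the symplectic automorphism `g ⊕ g` of the Heisenberg group of `W ⊕ W⁻`; by the tree's two-factor Schur
lemma (`AdelicMetaplecticTensorSchur`, `AdelicMetaplecticSeesawSum.mpSeesawCharSum`) they differ by a scalar:

* §1 **`doublingDefectChar F T hT : Mp_ψ(W_𝔸)ᶜᵒⁿᵗ →* ℂˣ`** (a HOMOMORPHISM) with
  **`ω(S̃(π x)) (Φ₁ ⊠ Ψ₂) = doublingDefectChar x • (ω(x) Φ₁ ⊠ ω_{−T}(xᶜ) Ψ₂)`** (`omega_doublingLift_proj_sumTensor`) and its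
  conjugate form **`ω(S̃(π x)) (Φ₁ ⊠ Φ̄₂) = doublingDefectChar x • (ω(x) Φ₁ ⊠ conj (ω(x) Φ₂))`**
  (`omega_doublingLift_proj_sumTensor_conj`) — «the restriction of `ω□` to the diagonal is `ω ⊗ ω*`» ([Li1992, p. 181];
  [HarrisKudlaSweet1996, §1]) UP TO this character;
* §2 **`doublingDefectChar x = 1` whenever `x` fixes `Θ` and lies over a rational point** (`π x = ratSp γ`) — the three
  operators `S̃(ratSp γ) = r_F(γ^Δ)` (`doublingLift_ratSp`), `x`, `xᶜ` then fix `Θ` (`doublingDefectChar_eq_one_of_mem_adelicMpTheta`);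
  in particular along any COMPATIBLE splitting `s` of a dual pair the character `doublingDefectChar ∘ s` is AUTOMORPHIC
  (trivial on rational points);
* §3 the THETA-KERNEL form: **`Θ(ω(S̃(π x))(Φ₁ ⊠ Φ̄₂)) = doublingDefectChar x · Θ(ω(x) Φ₁) · conj Θ(ω(x) Φ₂)`**
  (`thetaDistLM_omega_doublingLift_proj_sumTensor_conj`) — the diagonal see-saw identity of theta kernels
  `θ□_{Φ₁ ⊗ Φ̄₂}(g^Δ) = θ_{Φ₁}(g) \overline{θ_{Φ₂}(g)}` of the doubling method ([Li1992, (24) p. 184];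
  [GanQiuTakeda2014, §1.3]) up to the character.

WHAT IS NOT HERE: the triviality `doublingDefectChar x = 1` for `L²`-unitary `x` over NON-rational points (equivalently:
the doubling lift restricted to the diagonal IS `ω ⊗ ω̄` — [Kudla1994, Thm. 3.1]∕[HarrisKudlaSweet1996, §1], the
multiplicativity `χ_{W ⊕ W⁻} = χ_W χ_W⁻¹ = 1` of the splitting characters); on the centre `(1, λ)` the character is
`|λ|⁻²`, so unitarity is needed.  That statement is the separate stub of the E-2 Siegel–Weil sub-line.

## References
* [Li1992] J.-S. Li, J. reine angew. Math. 428 (1992) 177–217, p. 181 (`ω ⊗ ω*` and `Sp(𝕎 ⊕ 𝕎⁻)`), (24) p. 184.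
* [HarrisKudlaSweet1996] M. Harris, S. Kudla, W. J. Sweet, J. AMS 9 (1996) 941–1004, §1 (1.2)–(1.8).
* [GelbartPiatetskishapiroRallis1987] S. Gelbart, I. Piatetski-Shapiro, S. Rallis, LNM 1254 (1987), Part A §2 pp. 7–9.
* [Kudla1996] S. S. Kudla, *Notes on the local theta correspondence* (1996), V.3.
* [Weil1964] A. Weil, Acta Math. 111 (1964) 143–211, Chap. III n° 37–38 pp. 188–190, n° 41 Thm 6 p. 193.
* [GanQiuTakeda2014] W. T. Gan, Y. Qiu, S. Takeda, Invent. Math. 198 (2014), §1.3.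
-/

noncomputable section

open NumberField
open scoped ComplexConjugate

namespace Literature.NumberTheory.Weil1964

open Literature.RepresentationTheory.HeisenbergGroup Literature.NumberTheory.Automorphic
open Literature.NumberTheory.Automorphic.UnitaryGroup (spReindex spSum reindexW reindexW_apply reindexW_symm_apply
  spSumEquiv spSumEquiv_apply coe_spSum coe_spReindex_apply coe_spReindex)

section Defect

variable (F : Type) [Field F] [NumberField F] {n : ℕ}
variable (T : Matrix (Fin n) (Fin n) (AdeleRing (𝓞 F) F)) (hT : IsUnit T.det)

/-! ## §1 The defect character -/

/-- `Fin (n + n) ≃ Fin n ⊕ Fin n` reads the doubled Gram matrix as the block sum `T ⊕ (−T)` (the Gram matrix of the doubled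
space `W ⊕ W⁻`). [cite: Kudla1996, V.3] -/
theorem reindex_symm_doubledGramFin :
    Matrix.reindex finSumFinEquiv.symm finSumFinEquiv.symm (doubledGramFin F T) = Matrix.fromBlocks T 0 0 (-T) := by
  rw [doubledGramFin_eq, ← Matrix.reindex_symm, Equiv.symm_apply_apply]

/-- **the doubling lift read on `Mp_ψ(W_𝔸)ᶜᵒⁿᵗ`**: `x ↦ S̃(π x)`. [cite: GelbartPiatetskishapiroRallis1987, Part A §2 pp. 7–9] -/
def doublingLiftMp : adelicMpCont F (Fin n) T →* adelicMpCont F (Fin (n + n)) (doubledGramFin F T) :=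
  (doublingLift F T hT).comp (adelicMpCont.proj F (Fin n) T)

/-- Unfolding: `S̃` read on `Mp` is `S̃ ∘ π`. [cite: GelbartPiatetskishapiroRallis1987, Part A §2 pp. 7–9] -/
@[simp] theorem doublingLiftMp_apply (x : adelicMpCont F (Fin n) T) :
    doublingLiftMp F T hT x = doublingLift F T hT (adelicMpCont.proj F (Fin n) T x) := rfl

/-- **the conjugate model as a homomorphism** `x ↦ xᶜ : Mp_ψ(W_T)ᶜᵒⁿᵗ →* Mp_ψ(W_{−T})ᶜᵒⁿᵗ`. [cite: Li1992, p. 181] -/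
def conjMp : adelicMpCont F (Fin n) T →* adelicMpCont F (Fin n) (-T) :=
  (adelicMpContConj F (Fin n) T).toMonoidHom

/-- Unfolding: `conjMp x = xᶜ`. [cite: Li1992, p. 181] -/
@[simp] theorem conjMp_apply (x : adelicMpCont F (Fin n) T) : conjMp F T x = adelicMpContConj F (Fin n) T x := rfl

/-- round trip of the coordinate readers around an automorphism `L` of `W_𝔸`:
`W_{e⁻¹} (W_e (L (W_e⁻¹ ((W_{e⁻¹})⁻¹ v)))) = L v`. [folklore] -/
private theorem reindexW_roundtrip {ι ι' : Type*} (e : ι ≃ ι')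
    (L : ((ι → AdeleRing (𝓞 F) F) × (ι → AdeleRing (𝓞 F) F)) ≃ₗ[AdeleRing (𝓞 F) F]
      ((ι → AdeleRing (𝓞 F) F) × (ι → AdeleRing (𝓞 F) F)))
    (v : (ι → AdeleRing (𝓞 F) F) × (ι → AdeleRing (𝓞 F) F)) :
    reindexW (AdeleRing (𝓞 F) F) e.symm (reindexW (AdeleRing (𝓞 F) F) e
      (L ((reindexW (AdeleRing (𝓞 F) F) e).symm ((reindexW (AdeleRing (𝓞 F) F) e.symm).symm v)))) = L v := by
  have h1 : (reindexW (AdeleRing (𝓞 F) F) e).symm ((reindexW (AdeleRing (𝓞 F) F) e.symm).symm v) = v := by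
    refine Prod.ext (funext fun i => ?_) (funext fun i => ?_) <;>
      simp only [reindexW_symm_apply, Function.comp_apply, Equiv.symm_apply_apply]
  have h2 : ∀ w : (ι → AdeleRing (𝓞 F) F) × (ι → AdeleRing (𝓞 F) F),
      reindexW (AdeleRing (𝓞 F) F) e.symm (reindexW (AdeleRing (𝓞 F) F) e w) = w := fun w => by
    refine Prod.ext (funext fun i => ?_) (funext fun i => ?_) <;>
      simp only [reindexW_apply, Function.comp_apply, Equiv.symm_symm, Equiv.symm_apply_apply]
  rw [h1, h2]

/-- **the see-saw compatibility of `(S̃ ∘ π, id, ᶜ)` read through `Fin (n + n) ≃ Fin n ⊕ Fin n`**: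
`π(S̃(π x)) = π(x) ⊕ π(xᶜ)` as automorphisms of `𝔸^{n ⊕ n} × 𝔸^{n ⊕ n}`. [cite: Kudla1996, V.3] -/
theorem spReindex_proj_doublingLiftMp (x : adelicMpCont F (Fin n) T) :
    (spReindex finSumFinEquiv.symm (doubledGramFin F T)
        (adelicMpCont.proj F (Fin (n + n)) (doubledGramFin F T) (doublingLiftMp F T hT x))).1 =
      (spSum T (-T) (adelicMpCont.proj F (Fin n) T x, adelicMpCont.proj F (Fin n) (-T) (conjMp F T x))).1 := by
  have h1 : adelicMpCont.proj F (Fin (n + n)) (doubledGramFin F T) (doublingLiftMp F T hT x) =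
      spReindex finSumFinEquiv (Matrix.fromBlocks T 0 0 (-T)) (spDiag T (adelicMpCont.proj F (Fin n) T x)) :=
    proj_doublingLift F T hT _
  have h2 : (((adelicMpCont.proj F (Fin n) (-T) (conjMp F T x)) : symplecticGroup (polar (adelicForm F (Fin n) (-T)))) :
      ((Fin n → AdeleRing (𝓞 F) F) × (Fin n → AdeleRing (𝓞 F) F)) ≃ₗ[AdeleRing (𝓞 F) F]
        ((Fin n → AdeleRing (𝓞 F) F) × (Fin n → AdeleRing (𝓞 F) F))) =
      (adelicMpCont.proj F (Fin n) T x : symplecticGroup (polar (adelicForm F (Fin n) T))) :=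
    coe_proj_adelicMpContConj x
  refine LinearEquiv.ext fun v => ?_
  calc (spReindex finSumFinEquiv.symm (doubledGramFin F T)
        (adelicMpCont.proj F (Fin (n + n)) (doubledGramFin F T) (doublingLiftMp F T hT x))).1 v
      = (spReindex finSumFinEquiv.symm (doubledGramFin F T)
          (spReindex finSumFinEquiv (Matrix.fromBlocks T 0 0 (-T)) (spDiag T (adelicMpCont.proj F (Fin n) T x)))).1 v :=
        congrArg (fun y => ((spReindex finSumFinEquiv.symm (doubledGramFin F T) y).1) v) h1
    _ = reindexW (AdeleRing (𝓞 F) F) finSumFinEquiv.symm (reindexW (AdeleRing (𝓞 F) F) finSumFinEquiv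
          ((spDiag T (adelicMpCont.proj F (Fin n) T x)).1 ((reindexW (AdeleRing (𝓞 F) F) finSumFinEquiv).symm
            ((reindexW (AdeleRing (𝓞 F) F) finSumFinEquiv.symm).symm v)))) :=
        (coe_spReindex_apply finSumFinEquiv.symm (doubledGramFin F T) _ v).trans
          (congrArg (reindexW (AdeleRing (𝓞 F) F) finSumFinEquiv.symm)
            (coe_spReindex_apply finSumFinEquiv (Matrix.fromBlocks T 0 0 (-T))
              (spDiag T (adelicMpCont.proj F (Fin n) T x)) _))
    _ = (spDiag T (adelicMpCont.proj F (Fin n) T x)).1 v := reindexW_roundtrip F finSumFinEquiv _ v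
    _ = spSumEquiv ((adelicMpCont.proj F (Fin n) T x).1) ((adelicMpCont.proj F (Fin n) T x).1) v :=
        (coe_spDiag_apply T (adelicMpCont.proj F (Fin n) T x) v).trans
          (spSumEquiv_apply ((adelicMpCont.proj F (Fin n) T x).1) ((adelicMpCont.proj F (Fin n) T x).1) v).symm
    _ = spSumEquiv ((adelicMpCont.proj F (Fin n) T x).1) ((adelicMpCont.proj F (Fin n) (-T) (conjMp F T x)).1) v :=
        congrArg (fun L : ((Fin n → AdeleRing (𝓞 F) F) × (Fin n → AdeleRing (𝓞 F) F)) ≃ₗ[AdeleRing (𝓞 F) F]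
            ((Fin n → AdeleRing (𝓞 F) F) × (Fin n → AdeleRing (𝓞 F) F)) =>
              spSumEquiv ((adelicMpCont.proj F (Fin n) T x).1) L v) h2.symm
    _ = (spSum T (-T) (adelicMpCont.proj F (Fin n) T x, adelicMpCont.proj F (Fin n) (-T) (conjMp F T x))).1 v :=
        (LinearEquiv.congr_fun (coe_spSum T (-T)
          (adelicMpCont.proj F (Fin n) T x, adelicMpCont.proj F (Fin n) (-T) (conjMp F T x))) v).symm

/-- **THE DEFECT CHARACTER OF THE DOUBLING LIFT** `Mp_ψ(W_𝔸)ᶜᵒⁿᵗ →* ℂˣ`: the see-saw character (two-factor Schur scalar,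
`AdelicMetaplecticSeesawSum.mpSeesawCharSum` read through `Fin (n + n) ≃ Fin n ⊕ Fin n`) of the triple
`(x ↦ S̃(π x), x ↦ x, x ↦ xᶜ)` — for `x = (g, M)` the scalar by which `ω(S̃(g))` differs from `M ⊠ C M C`.
[cite: Weil1964, Chap. III n° 37–38 pp. 188–190] [cite: Li1992, p. 181] -/
def doublingDefectChar : adelicMpCont F (Fin n) T →* ℂˣ :=
  mpSeesawCharSum finSumFinEquiv.symm (reindex_symm_doubledGramFin F T) (doublingLiftMp F T hT)
    (MonoidHom.id _) (conjMp F T) (spReindex_proj_doublingLiftMp F T hT) ((Matrix.isUnit_iff_isUnit_det T).mpr hT)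
      ((Matrix.isUnit_iff_isUnit_det T).mpr hT).neg

/-- Unfolding (so that all of `AdelicMetaplecticSeesawSum`∕`…Character` applies): the defect character IS the see-saw
character of `(S̃ ∘ π, id, ᶜ)`. [cite: Weil1964, Chap. III n° 37–38 pp. 188–190] -/
theorem doublingDefectChar_def : doublingDefectChar F T hT =
    mpSeesawCharSum finSumFinEquiv.symm (reindex_symm_doubledGramFin F T) (doublingLiftMp F T hT)
      (MonoidHom.id _) (conjMp F T) (spReindex_proj_doublingLiftMp F T hT) ((Matrix.isUnit_iff_isUnit_det T).mpr hT)
      ((Matrix.isUnit_iff_isUnit_det T).mpr hT).neg :=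
  rfl

/-- **`Φ₁ ⊠ Ψ₂` read on `Fin (n + n)`** is the tree's `sumTensor` along `Fin (n + n) ≃ Fin n ⊕ Fin n`:
`sumTensor F finSumFinEquiv.symm Φ₁ Ψ₂ = R_{e₂} (Φ₁ ⊠ Ψ₂)` (definitional; Weil's «standard functions on a direct sum»).
[cite: Weil1964, Chap. III n° 38 pp. 189–190] -/
theorem sumTensor_finSumFinEquiv_symm (Φ₁ Ψ₂ : piSchwartzBruhat F (Fin n)) :
    sumTensor F finSumFinEquiv.symm Φ₁ Ψ₂ = piSBReindex F finSumFinEquiv (tensorToSum F (Fin n) (Fin n) Φ₁ Ψ₂) :=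
  rfl

/-- **THE DOUBLING LIFT ON THE DIAGONAL IS `ω ⊗ ω_{−T} ∘ ᶜ` UP TO THE DEFECT CHARACTER**:
`ω(S̃(π x)) (Φ₁ ⊠ Ψ₂) = doublingDefectChar x • (ω(x) Φ₁ ⊠ ω_{−T}(xᶜ) Ψ₂)`.
[cite: Weil1964, Chap. III n° 37–38 pp. 188–190] [cite: HarrisKudlaSweet1996, §1] -/
theorem omega_doublingLiftMp_sumTensor (x : adelicMpCont F (Fin n) T) (Φ₁ Ψ₂ : piSchwartzBruhat F (Fin n)) :
    adelicMpCont.omega F (Fin (n + n)) (doubledGramFin F T) (doublingLiftMp F T hT x)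
        (sumTensor F finSumFinEquiv.symm Φ₁ Ψ₂) =
      (doublingDefectChar F T hT x : ℂ) •
        sumTensor F finSumFinEquiv.symm (adelicMpCont.omega F (Fin n) T x Φ₁)
          (adelicMpCont.omega F (Fin n) (-T) (adelicMpContConj F (Fin n) T x) Ψ₂) :=
  mpSeesawCharSum_spec finSumFinEquiv.symm (reindex_symm_doubledGramFin F T) (doublingLiftMp F T hT)
    (MonoidHom.id _) (conjMp F T) (spReindex_proj_doublingLiftMp F T hT) ((Matrix.isUnit_iff_isUnit_det T).mpr hT)
      ((Matrix.isUnit_iff_isUnit_det T).mpr hT).neg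
    x Φ₁ Ψ₂

/-- **… `= ω ⊗ ω̄` UP TO THE DEFECT CHARACTER** (insert `Ψ₂ = Φ̄₂`, `ω_{−T}(xᶜ) Φ̄₂ = conj (ω(x) Φ₂)`):
`ω(S̃(π x)) (Φ₁ ⊠ Φ̄₂) = doublingDefectChar x • (ω(x) Φ₁ ⊠ conj (ω(x) Φ₂))` — «the restriction of `ω□` to `G` is `ω ⊗ ω*`»
([Li1992, p. 181]) for a chosen implementer, up to the character. [cite: Li1992, p. 181] [cite: HarrisKudlaSweet1996, §1] -/
theorem omega_doublingLiftMp_sumTensor_conj (x : adelicMpCont F (Fin n) T) (Φ₁ Φ₂ : piSchwartzBruhat F (Fin n)) :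
    adelicMpCont.omega F (Fin (n + n)) (doubledGramFin F T) (doublingLiftMp F T hT x)
        (sumTensor F finSumFinEquiv.symm Φ₁ (piSchwartzBruhatConj F (Fin n) Φ₂)) =
      (doublingDefectChar F T hT x : ℂ) •
        sumTensor F finSumFinEquiv.symm (adelicMpCont.omega F (Fin n) T x Φ₁)
          (piSchwartzBruhatConj F (Fin n) (adelicMpCont.omega F (Fin n) T x Φ₂)) :=
  (omega_doublingLiftMp_sumTensor F T hT x Φ₁ (piSchwartzBruhatConj F (Fin n) Φ₂)).trans
    (congrArg (fun Ψ => (doublingDefectChar F T hT x : ℂ) •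
        sumTensor F finSumFinEquiv.symm (adelicMpCont.omega F (Fin n) T x Φ₁) Ψ)
      ((adelicMpCont.omega_adelicMpContConj_apply x (piSchwartzBruhatConj F (Fin n) Φ₂)).trans
        (congrArg (fun Φ => piSchwartzBruhatConj F (Fin n) (adelicMpCont.omega F (Fin n) T x Φ))
          (piSchwartzBruhatConj_piSchwartzBruhatConj Φ₂))))

/-! ## §2 Triviality at `Θ`-fixing rational points -/

/-- **`doublingDefectChar x = 1` when `x` fixes `Θ` and lies over a rational point `ratSp γ`**: then `S̃(π x) = S̃(ratSp γ)`
fixes `Θ` (`doublingLift_ratSp_mem_adelicMpTheta`), `x` does, and so does `xᶜ` (`adelicMpContConj_mem_adelicMpTheta_iff`);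
three `Θ`-fixing operators have see-saw scalar `1` (`Θ(Φ₁ ⊠ Ψ₂) = Θ(Φ₁) Θ(Ψ₂) ≠ 0` detects it).
[cite: Weil1964, Chap. III n° 41 Thm 6 p. 193] -/
theorem doublingDefectChar_eq_one_of_mem_adelicMpTheta {x : adelicMpCont F (Fin n) T}
    (hx : (x : adelicMp F (Fin n) T) ∈ adelicMpTheta F (Fin n) T) {γ : Matrix.symplecticGroup (Fin n) F}
    (hγ : adelicMpCont.proj F (Fin n) T x = ratSp F T hT γ) :
    doublingDefectChar F T hT x = 1 := by
  refine mpSeesawCharSum_eq_one_of_mem_adelicMpTheta finSumFinEquiv.symm (reindex_symm_doubledGramFin F T)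
    (doublingLiftMp F T hT) (MonoidHom.id _) (conjMp F T) (spReindex_proj_doublingLiftMp F T hT)
    ((Matrix.isUnit_iff_isUnit_det T).mpr hT)
      ((Matrix.isUnit_iff_isUnit_det T).mpr hT).neg ?_ hx ?_
  · have h1 : doublingLift F T hT (ratSp F T hT γ) = doublingLiftMp F T hT x :=
      congrArg (doublingLift F T hT) hγ.symm
    exact (congrArg (fun y : adelicMpCont F (Fin (n + n)) (doubledGramFin F T) =>
        (y : adelicMp F (Fin (n + n)) (doubledGramFin F T)) ∈ adelicMpTheta F (Fin (n + n)) (doubledGramFin F T)) h1).mp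
      (doublingLift_ratSp_mem_adelicMpTheta F T hT γ)
  · exact (adelicMpContConj_mem_adelicMpTheta_iff x).2 hx

/-! ## §3 The theta-kernel form: the diagonal see-saw identity up to the defect character -/

/-- `Θ` of the `Fin (n + n)`-read external tensor is the product: `Θ(Φ₁ ⊠ Ψ₂) = Θ(Φ₁) Θ(Ψ₂)`.
[cite: Weil1964, Chap. III n° 41 Thm 6 p. 193] -/
theorem thetaDistLM_sumTensor_finSumFinEquiv_symm (Φ₁ Ψ₂ : piSchwartzBruhat F (Fin n)) :
    thetaDistLM F (Fin (n + n)) (sumTensor F finSumFinEquiv.symm Φ₁ Ψ₂) =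
      thetaDistLM F (Fin n) Φ₁ * thetaDistLM F (Fin n) Ψ₂ := by
  rw [sumTensor_finSumFinEquiv_symm, thetaDistLM_piSBReindex, thetaDistLM_tensorToSum]

/-- **THE DIAGONAL SEE-SAW IDENTITY OF THETA KERNELS, UP TO THE DEFECT CHARACTER**:
`Θ(ω(S̃(π x)) (Φ₁ ⊠ Φ̄₂)) = doublingDefectChar x · Θ(ω(x) Φ₁) · conj Θ(ω(x) Φ₂)` — for `x = s(g)` along a dual-pair splitting
this is `θ□_{Φ₁ ⊗ Φ̄₂}(g^Δ) = χ(g) θ_{Φ₁}(g) \overline{θ_{Φ₂}(g)}`, the inner integrand of [Li1992, (24)] ∕ [GanQiuTakeda2014, §1.3].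
[cite: Li1992, (24) p. 184 and p. 181] -/
theorem thetaDistLM_omega_doublingLiftMp_sumTensor_conj (x : adelicMpCont F (Fin n) T) (Φ₁ Φ₂ : piSchwartzBruhat F (Fin n)) :
    thetaDistLM F (Fin (n + n)) (adelicMpCont.omega F (Fin (n + n)) (doubledGramFin F T) (doublingLiftMp F T hT x)
        (sumTensor F finSumFinEquiv.symm Φ₁ (piSchwartzBruhatConj F (Fin n) Φ₂))) =
      (doublingDefectChar F T hT x : ℂ) *
        (thetaDistLM F (Fin n) (adelicMpCont.omega F (Fin n) T x Φ₁) *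
          conj (thetaDistLM F (Fin n) (adelicMpCont.omega F (Fin n) T x Φ₂))) := by
  refine (congrArg (thetaDistLM F (Fin (n + n))) (omega_doublingLiftMp_sumTensor_conj F T hT x Φ₁ Φ₂)).trans ?_
  refine (LinearMap.map_smul (thetaDistLM F (Fin (n + n))) (doublingDefectChar F T hT x : ℂ) _).trans ?_
  refine congrArg (fun t : ℂ => (doublingDefectChar F T hT x : ℂ) • t)
    (thetaDistLM_sumTensor_finSumFinEquiv_symm F (adelicMpCont.omega F (Fin n) T x Φ₁)
      (piSchwartzBruhatConj F (Fin n) (adelicMpCont.omega F (Fin n) T x Φ₂))) |>.trans ?_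
  exact (smul_eq_mul _ _).trans (congrArg (fun t : ℂ => (doublingDefectChar F T hT x : ℂ) *
    (thetaDistLM F (Fin n) (adelicMpCont.omega F (Fin n) T x Φ₁) * t))
      (thetaDistLM_piSchwartzBruhatConj (adelicMpCont.omega F (Fin n) T x Φ₂)))

/-- **… at a point where the defect character is `1`** (e.g. `Θ`-fixing rational points, §2; or any `L²`-unitary point once
the triviality of the defect character is available): `Θ(ω(S̃(π x)) (Φ₁ ⊠ Φ̄₂)) = Θ(ω(x) Φ₁) · conj Θ(ω(x) Φ₂)`.
[cite: Li1992, (24) p. 184 and p. 181] -/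
theorem thetaDistLM_omega_doublingLiftMp_sumTensor_conj_of_eq_one {x : adelicMpCont F (Fin n) T}
    (hx : doublingDefectChar F T hT x = 1) (Φ₁ Φ₂ : piSchwartzBruhat F (Fin n)) :
    thetaDistLM F (Fin (n + n)) (adelicMpCont.omega F (Fin (n + n)) (doubledGramFin F T) (doublingLiftMp F T hT x)
        (sumTensor F finSumFinEquiv.symm Φ₁ (piSchwartzBruhatConj F (Fin n) Φ₂))) =
      thetaDistLM F (Fin n) (adelicMpCont.omega F (Fin n) T x Φ₁) *
        conj (thetaDistLM F (Fin n) (adelicMpCont.omega F (Fin n) T x Φ₂)) := by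
  have h1 : ((doublingDefectChar F T hT x : ℂˣ) : ℂ) = 1 := (congrArg Units.val hx).trans Units.val_one
  exact (thetaDistLM_omega_doublingLiftMp_sumTensor_conj F T hT x Φ₁ Φ₂).trans
    (((congrArg (· * (thetaDistLM F (Fin n) (adelicMpCont.omega F (Fin n) T x Φ₁) *
      conj (thetaDistLM F (Fin n) (adelicMpCont.omega F (Fin n) T x Φ₂)))) h1)).trans (one_mul _))

end Defect

end Literature.NumberTheory.Weil1964

end
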